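import Literature.NumberTheory.GaloisRepresentations.InducedGaloisRep
import Literature.NumberTheory.GaloisRepresentations.AdmissibleRestrictOfRingEquiv
import Literature.NumberTheory.GaloisRepresentations.PotentialDiagonalizabilityCriteriaProofs
import Literature.NumberTheory.PAdicHodge.DeRhamBaseChangeProofs
import Literature.NumberTheory.GaloisRepresentations.PstWeilDeligneModelIndependence
import HarnessLib

/-!
# Induction and de Rham-ness: Frobenius reciprocity for period rings (Patrikis 2019, Lemma 7.2.1)

Topic `NumberTheory/PAdicHodge`; theorems only (no definition, no named fact; D-0026).

Patrikis, *Variations on a theorem of Tate*, Lemma 7.2.1 (§7.2; arXiv:1207.6724 p. 38): "Let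
`L/K/ℚ_ℓ` be finite, and let `W` be a de Rham representation of `Γ_L`. Then `V = Ind_L^K W` is also de
Rham […] this follows almost immediately from Frobenius reciprocity if one uses contravariant Fontaine
functors: `D_dR^*(V) := Hom_{Γ_K}(V, B_dR) ≅ Hom_{Γ_L}(W, B_dR|_{Γ_L}) = D_dR^*(W)` […] Comparing
dimensions, it is clear that `V` is de Rham if and only if `W` is."  This file proves the de Rham
statement for THE pinned Fontaine data of the tree (`fontainePst`, whose period ring IS the constructed
`B_dR`, `fontainePst_𝔅_eq_bdRPeriodRingData`) and for the tree's matrix model of induction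
(`FramedRep.induce`, Serre §3.3), following the printed proof in covariant form ("in coordinates"):

* §1 (abstract, any period-ring data `𝔅 = (B, Γ, F)`, `𝔅' = (B', Γ', F')` over `P` with a `P`-linear
  ring isomorphism `Φ : B ≃ B'` equivariant through an open embedding `φ : Γ' → Γ` of finite index):
  `exists_perm_mul_transversal_eq` (left multiplication permutes a transversal, `g tᵢ = t_{π i} φ(uᵢ)`),
  `restrictScalars_induce_comp_emb` (the column blocks of `Ind(rE)(g)`),
  `exists_linearIndependent_invariant_of_isAdmissible` (transport of Fontaine's comparison basis of
  `B' ⊗ W` along `Φ⁻¹ ⊗ 1`), `exists_frobeniusReciprocity_map` (**Frobenius reciprocity**: the injective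
  `F`-linear `Θ : (B ⊗ W)^{φ(Γ')} → (B ⊗ Ind W)^Γ`, `y ↦ ∑ᵢ (tᵢ ⊗ embᵢ) y`),
  `isAdmissible_restrictScalars_induce` (**comparing dimensions**: with an `F`-subspace `S ⊆ B` fixed by
  `φ(Γ')` of dimension `≥ [Γ : φ(Γ')]` — in the application `S = L ⊆ K̄ ⊆ B_dR(K)` — one gets
  `dim_F D_B(Ind W) ≥ dim_P Ind W`, and Fontaine's inequality `finrank_D_le_holds` is the reverse
  bound), and the counit side `isAdmissible_restrictScalars_of_induce_comp` (`rE` is the quotient of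
  `Ind(rE ∘ φ)` by `(vᵢ) ↦ ∑ rE(tᵢ) vᵢ`; quotients of admissible representations are admissible,
  Fontaine Exp. III Prop. 1.5.2, the tree's `isAdmissible_of_shortExact`).
* §2 (the pinned data): `finiteDimensional_of_continuous_algebraMap` (a continuous embedding of
  `ℓ`-adic local fields is finite), `isAdmissible_bdR_induce` (§1 for `B_dR(K) ≃ B_dR(L)` of the tree's
  `exists_fracBdR_ringEquiv`, with `S = L`), **`isDeRhamFramed_fontainePst_induce`** (THE LOCAL
  INDUCTION THEOREM: `W` de Rham for `fontainePst L` ⇒ `Ind_{Γ_L}^{Γ_K} W` de Rham for `fontainePst K`,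
  on a finite `ℚ_ℓ`-model `Ind rE` of `Ind W`), and its corollary
  **`isDeRhamFramed_of_isDeRhamFramed_comp_absGaloisRestrict`** (DE RHAM DESCENT, Brinon–Conrad
  Prop. 6.3.8 converse half, the body of the named fact `DeRhamDescent`: `ρ|_{Γ_L}` de Rham ⇒ `ρ` de
  Rham, `ρ` being a quotient of `Ind(ρ|_{Γ_L})`; model independence `isDeRhamFramed_iff_of_hasQlModel`).

These are the local inputs of the discharge of the schema `IsDeRhamFramedInduceSchema`
(`FontainePstInductionSchemata`; global form over number fields, file
`FontainePstInductionSchemataProofs`).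

What is NOT here: the filtered statement "`D_dR(V)` is the image of `D_dR(W)` under the forgetful
functor `Fil_L → Fil_K`" and the crystalline clause of Lemma 7.2.1; the converse "`Ind W` de Rham ⇒
`W` de Rham" over a local base (the global form over `ℚ` is the tree's
`isDeRhamFramed_of_isDeRhamFramed_induce_holds`).

## References

* [Patrikis2019] S. Patrikis, *Variations on a theorem of Tate*, Mem. Amer. Math. Soc. 258 (2019),
  no. 1238 (arXiv:1207.6724): §7.2, Lemma 7.2.1 and its proof (p. 38 of the arXiv text).
* [FontaineAsterisque223III] J.-M. Fontaine, *Représentations p-adiques semi-stables*, Astérisque 223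
  (1994), Exp. III, Prop. 1.5.2 and Thm. 1.5.2 (comparison isomorphism; sub-objects and quotients).
* [BrinonConrad2009] O. Brinon, B. Conrad, *CMI Summer School notes on p-adic Hodge theory* (2009),
  Prop. 6.3.8 (de Rham-ness is insensitive to finite extension of the base).
* [SerreLinearRepresentations1977] J.-P. Serre, *Linear representations of finite groups*, GTM 42
  (1977), §3.3 (matrix form of `Ind`, proof of Thm. 12), §7.2 (Frobenius reciprocity).
* [NeukirchANT1999] J. Neukirch, *Algebraic Number Theory* (1999), Ch. II (5.2), Ch. IV §1.
-/

noncomputable section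

open scoped TensorProduct Matrix
open Topology TensorProduct

namespace Literature.NumberTheory.GaloisRepresentations

/-! ### The coset permutation of a transversal -/

section Transversal

variable {H G : Type*} [Group H] [Group G] {ι : Type*}

/-- **Left multiplication permutes a transversal.**  For a transversal `t : ι → G` of `G / φ(H)`
(`ι` finite) and `g ∈ G` there are a permutation `π` of `ι` and elements `u i ∈ H` with
`g · t i = t (π i) · φ (u i)` — the permutation of the cosets `t i · φ(H)` by `g` and the
"`H`-parts" entering the matrix form of the induced representation.
Ref: Serre, *Linear representations of finite groups*, §3.3 (proof of Thm. 12: `u r = r_u t`).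
[cite: SerreLinearRepresentations1977, §3.3 Thm. 12 (proof)] -/
theorem exists_perm_mul_transversal_eq [Finite ι] (φ : H →* G) {t : ι → G}
    (ht : Function.Bijective fun i => (t i : G ⧸ φ.range)) (g : G) :
    ∃ (π : ι ≃ ι) (u : ι → H), ∀ i, g * t i = t (π i) * φ (u i) := by
  classical
  have hk : ∀ i, ∃ k, (t k : G ⧸ φ.range) = (g * t i : G) := fun i => ht.2 _
  choose k hk using hk
  have hu : ∀ i, ∃ u : H, φ u = (t (k i))⁻¹ * (g * t i) := fun i => by
    have h := QuotientGroup.eq.1 (hk i)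
    obtain ⟨u, hu⟩ := h
    exact ⟨u, hu⟩
  choose u hu using hu
  have hkinj : Function.Injective k := by
    intro i j hij
    apply ht.1
    change (t i : G ⧸ φ.range) = (t j : G ⧸ φ.range)
    rw [QuotientGroup.eq]
    have h1 : (g * t i : G ⧸ φ.range) = (g * t j : G ⧸ φ.range) := by rw [← hk i, ← hk j, hij]
    have h2 := QuotientGroup.eq.1 h1
    simpa [mul_inv_rev, mul_assoc] using h2
  refine ⟨Equiv.ofBijective k (Finite.injective_iff_bijective.1 hkinj), u, fun i => ?_⟩
  rw [Equiv.ofBijective_apply, hu, mul_inv_cancel_left]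

/-- For a transversal `t` of `G / φ(H)`: `(t k)⁻¹ · t k' · φ u ∈ φ(H)` forces `k = k'`. [folklore] -/
theorem eq_of_inv_mul_mul_map_mem (φ : H →* G) {t : ι → G}
    (ht : Function.Injective fun i => (t i : G ⧸ φ.range)) {k k' : ι} {u : H}
    (h : (t k)⁻¹ * (t k' * φ u) ∈ φ.range) : k = k' := by
  apply ht
  change (t k : G ⧸ φ.range) = (t k' : G ⧸ φ.range)
  rw [QuotientGroup.eq]
  have h2 : (t k)⁻¹ * (t k' * φ u) * (φ u)⁻¹ ∈ φ.range :=
    φ.range.mul_mem h (φ.range.inv_mem ⟨u, rfl⟩)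
  simpa [mul_assoc] using h2

end Transversal

namespace PeriodRingData

-- Mathlib's own global value of `maxSynthPendingDepth` (nested instance problems on `𝔅.B ⊗[P] M`,
-- see the note in `PAdicHodgeProofs`).
set_option maxSynthPendingDepth 3

universe u u' v v₁ v₂ w₁ w₂

section Shapiro

variable {Γ : Type u} {Γ' : Type u'} [Group Γ] [TopologicalSpace Γ] [Group Γ'] [TopologicalSpace Γ']
  {P : Type v} [Field P] [TopologicalSpace P] {F : Type v₁} {F' : Type v₂} [Field F] [Field F']
  [Algebra P F] [Algebra P F']
  (𝔅 : PeriodRingData.{u, v, v₁, w₁} Γ P F) (𝔅' : PeriodRingData.{u', v, v₂, w₂} Γ' P F')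
  {A : Type} [Field A] [Algebra P A] [TopologicalSpace A] [IsTopologicalRing A] {n : ℕ}

omit [TopologicalSpace Γ] in
/-- The "restricted diagonal action" of `τ ∈ Γ'` on `B ⊗_P Aⁿ` through `φ : Γ' → Γ` on the period
ring and `rE` on `Aⁿ`: `b ⊗ x ↦ φ(τ) b ⊗ rE(τ) x`, as an `F`-linear map; this is the diagonal action of
the subgroup `φ(Γ')` on `B ⊗ W`. [folklore] -/
theorem exists_restrictedTensorAction (φ : Γ' →* Γ) (rE : FramedRep Γ' A n) :
    ∃ T : Γ' → (𝔅.B ⊗[P] (Fin n → A) →ₗ[F] 𝔅.B ⊗[P] (Fin n → A)),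
      ∀ (τ : Γ') (b : 𝔅.B) (x : Fin n → A),
        T τ (b ⊗ₜ x) = (φ τ • b) ⊗ₜ (FramedRep.restrictScalars P rE τ x) :=
  ⟨fun τ => AlgebraTensorModule.map (DistribMulAction.toModuleEnd F 𝔅.B (φ τ))
    ((FramedRep.restrictScalars P rE τ : (Fin n → A) →ₗ[P] (Fin n → A))), fun _ _ _ => rfl⟩

omit [TopologicalSpace Γ] in
/-- The restricted diagonal action is semilinear over `B`: `T_τ (b • y) = φ(τ)(b) • T_τ y`. [folklore] -/
theorem restrictedTensorAction_smul (φ : Γ' →* Γ) (rE : FramedRep Γ' A n)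
    {T : Γ' → (𝔅.B ⊗[P] (Fin n → A) →ₗ[F] 𝔅.B ⊗[P] (Fin n → A))}
    (hT : ∀ (τ : Γ') (b : 𝔅.B) (x : Fin n → A),
      T τ (b ⊗ₜ x) = (φ τ • b) ⊗ₜ (FramedRep.restrictScalars P rE τ x))
    (τ : Γ') (b : 𝔅.B) (y : 𝔅.B ⊗[P] (Fin n → A)) :
    T τ (b • y) = (φ τ • b) • T τ y := by
  induction y using TensorProduct.induction_on with
  | zero => rw [smul_zero, map_zero, smul_zero]
  | tmul b' x =>
    rw [TensorProduct.smul_tmul', smul_eq_mul, hT, hT, TensorProduct.smul_tmul', smul_eq_mul,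
      smul_mul']
  | add y z hy hz => rw [smul_add, map_add, hy, hz, map_add, smul_add]

omit [TopologicalSpace Γ] in
/-- **Transport of the comparison basis along `Φ⁻¹ ⊗ 1`.**  If `W` (the `P`-restriction of a framed
`rE : Γ' → GL_n(A)`) is `B'`-admissible and `Φ : B ≃ B'` is a `P`-linear ring isomorphism with
`Φ (φ(τ) b) = τ Φ(b)`, then `B ⊗_P W` has a `B`-linearly independent family of `dim_P W` vectors fixed by
the restricted diagonal action of `Γ'` (the images under `Φ⁻¹ ⊗ 1` of a `B'`-basis of `B' ⊗ W` inside
`D_{B'}(W)`, Fontaine's comparison isomorphism `exists_basis_mem_D_of_isAdmissible`).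
[cite: FontaineAsterisque223III, Exp. III Thm. 1.5.2] -/
theorem exists_linearIndependent_invariant_of_isAdmissible [FiniteDimensional P A]
    (φ : Γ' →* Γ) (rE : FramedRep Γ' A n)
    (Φ : 𝔅.B ≃+* 𝔅'.B) (hΦP : ∀ c : P, Φ (algebraMap P 𝔅.B c) = algebraMap P 𝔅'.B c)
    (hΦ : ∀ (τ : Γ') (b : 𝔅.B), Φ (φ τ • b) = τ • Φ b)
    {T : Γ' → (𝔅.B ⊗[P] (Fin n → A) →ₗ[F] 𝔅.B ⊗[P] (Fin n → A))}
    (hT : ∀ (τ : Γ') (b : 𝔅.B) (x : Fin n → A),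
      T τ (b ⊗ₜ x) = (φ τ • b) ⊗ₜ (FramedRep.restrictScalars P rE τ x))
    (hadm : 𝔅'.IsAdmissible (FramedRep.restrictScalars P rE)) :
    ∃ x : Fin (Module.finrank P (Fin n → A)) → 𝔅.B ⊗[P] (Fin n → A),
      LinearIndependent 𝔅.B x ∧ ∀ τ j, T τ (x j) = x j := by
  obtain ⟨b', hb'⟩ := 𝔅'.exists_basis_mem_D_of_isAdmissible (FramedRep.restrictScalars P rE) hadm
  -- the two base changes `g = Φ ⊗ 1`, `f = Φ⁻¹ ⊗ 1`
  have hΦP' : ∀ c : P, Φ.symm (algebraMap P 𝔅'.B c) = algebraMap P 𝔅.B c := fun c => by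
    rw [← hΦP, RingEquiv.symm_apply_apply]
  obtain ⟨g, hg⟩ : ∃ g : 𝔅.B ⊗[P] (Fin n → A) →ₗ[P] 𝔅'.B ⊗[P] (Fin n → A),
      ∀ (b : 𝔅.B) (m : Fin n → A), g (b ⊗ₜ m) = Φ b ⊗ₜ m :=
    ⟨(AlgEquiv.ofRingEquiv (f := Φ) hΦP).toLinearMap.rTensor _, fun b m => by
      rw [LinearMap.rTensor_tmul, AlgEquiv.toLinearMap_apply, AlgEquiv.ofRingEquiv_apply]⟩
  obtain ⟨f, hf⟩ : ∃ f : 𝔅'.B ⊗[P] (Fin n → A) →ₗ[P] 𝔅.B ⊗[P] (Fin n → A),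
      ∀ (b : 𝔅'.B) (m : Fin n → A), f (b ⊗ₜ m) = Φ.symm b ⊗ₜ m :=
    ⟨(AlgEquiv.ofRingEquiv (f := Φ.symm) hΦP').toLinearMap.rTensor _, fun b m => by
      rw [LinearMap.rTensor_tmul, AlgEquiv.toLinearMap_apply, AlgEquiv.ofRingEquiv_apply]⟩
  have hgf : ∀ y, g (f y) = y := fun y => by
    induction y using TensorProduct.induction_on with
    | zero => rw [map_zero, map_zero]
    | tmul b m => rw [hf, hg, RingEquiv.apply_symm_apply]
    | add y z hy hz => rw [map_add, map_add, hy, hz]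
  have hginj : Function.Injective g := fun y z hyz => by
    have hfg : ∀ y, f (g y) = y := fun y => by
      induction y using TensorProduct.induction_on with
      | zero => rw [map_zero, map_zero]
      | tmul b m => rw [hg, hf, RingEquiv.symm_apply_apply]
      | add y z hy hz => rw [map_add, map_add, hy, hz]
    rw [← hfg y, ← hfg z, hyz]
  -- `g` intertwines the restricted action on `B ⊗ W` with the diagonal action on `B' ⊗ W`
  have hgT : ∀ τ y, g (T τ y) = 𝔅'.tensorRep (FramedRep.restrictScalars P rE) τ (g y) := by
    intro τ y
    induction y using TensorProduct.induction_on with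
    | zero => rw [map_zero, map_zero, map_zero]
    | tmul b m => rw [hT, hg, hg, tensorRep_apply_tmul, hΦ]
    | add y z hy hz => rw [map_add, map_add, hy, hz, map_add, map_add]
  refine ⟨fun j => f (b' j), ?_, fun τ j => hginj ?_⟩
  · -- linear independence over `B`: apply `g`, which is `Φ`-semilinear
    rw [linearIndependent_iff']
    intro s c hc j hj
    have hsemi : ∀ (b : 𝔅.B) (y : 𝔅.B ⊗[P] (Fin n → A)), g (b • y) = Φ b • g y :=
      𝔅.map_smul_of_apply_tmul 𝔅' Φ g hg
    have h0 : ∑ i ∈ s, Φ (c i) • b' i = 0 := by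
      have h := congrArg g hc
      rw [map_sum, map_zero] at h
      calc ∑ i ∈ s, Φ (c i) • b' i = ∑ i ∈ s, g (c i • f (b' i)) :=
            Finset.sum_congr rfl fun i _ => by rw [hsemi, hgf]
        _ = 0 := h
    have h1 := linearIndependent_iff'.1 b'.linearIndependent s (fun i => Φ (c i)) h0 j hj
    exact (map_eq_zero_iff Φ Φ.injective).1 h1
  · rw [hgT, hgf]
    exact (𝔅'.mem_D_iff _ _).1 (hb' j) τ


/-- **The column blocks of `Ind(rE)(g)`**: if `g · t i = t k · φ u` then `Ind(rE)(g)` maps the `i`-th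
copy of `Aⁿ` onto the `k`-th copy through `rE(u)` (Serre §3.3: "`ρ_u` sends `ρ_r W` into
`ρ_{r_u} W`", acting there through `θ_t`).  Here `emb i` places a vector in block `i` of `A^m`,
`m = |ι| n` relabelled by `e`. [cite: SerreLinearRepresentations1977, §3.3 Thm. 12 (proof)] -/
theorem restrictScalars_induce_comp_emb [IsTopologicalGroup Γ] {ι : Type} [Fintype ι] [DecidableEq ι]
    (φ : Γ' →* Γ) (hφ : IsOpenEmbedding φ) {t : ι → Γ}
    (ht : Function.Bijective fun i => (t i : Γ ⧸ φ.range)) {m : ℕ} (e : ι × Fin n ≃ Fin m)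
    (rE : FramedRep Γ' A n) {emb : ι → ((Fin n → A) →ₗ[P] (Fin m → A))}
    (hemb : ∀ i v c, emb i v c = if (e.symm c).1 = i then v (e.symm c).2 else 0)
    {g : Γ} {i k : ι} {u : Γ'} (hg : g * t i = t k * φ u) :
    (FramedRep.restrictScalars P (FramedRep.induce φ hφ t ht e rE) g :
        (Fin m → A) →ₗ[P] (Fin m → A)) ∘ₗ emb i =
      emb k ∘ₗ (FramedRep.restrictScalars P rE u : (Fin n → A) →ₗ[P] (Fin n → A)) := by
  refine LinearMap.ext fun v => funext fun c => ?_
  rw [LinearMap.comp_apply, LinearMap.comp_apply, FramedRep.restrictScalars_apply_apply, hemb,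
    FramedRep.restrictScalars_apply_apply, Matrix.mulVec, dotProduct]
  -- reindex the sum over `Fin m` along `e`
  rw [← e.sum_comp, Fintype.sum_prod_type]
  simp only [FramedRep.induce_apply_coe_apply, Equiv.symm_apply_apply, hemb]
  rw [Finset.sum_eq_single i]
  · simp only [if_true]
    have hti : (t (e.symm c).1)⁻¹ * g * t i = (t (e.symm c).1)⁻¹ * (t k * φ u) := by
      rw [mul_assoc, hg]
    rw [hti]
    by_cases hk : (e.symm c).1 = k
    · rw [if_pos hk, hk, inv_mul_cancel_left, dotExtend_apply_map hφ.injective]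
      rfl
    · rw [if_neg hk]
      have hnot : (t (e.symm c).1)⁻¹ * (t k * φ u) ∉ φ.range := fun hmem =>
        hk (eq_of_inv_mul_mul_map_mem φ ht.1 hmem)
      simp only [dotExtend_of_not_mem φ _ hnot, Matrix.zero_apply, zero_mul,
        Finset.sum_const_zero]
  · intro i' _ hi'
    simp only [if_neg hi', mul_zero, Finset.sum_const_zero]
  · intro h
    exact absurd (Finset.mem_univ i) h

/-- **Frobenius reciprocity for period rings (the map).**  For a transversal `t` of `Γ / φ(Γ')` and
the matrix model `Ind(rE)` of the induced representation on `A^m = ⊕ᵢ tᵢ Aⁿ`, the `F`-linear map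
`Θ : B ⊗_P Aⁿ → B ⊗_P A^m`, `y ↦ ∑ᵢ (tᵢ ⊗ embᵢ) y`, is injective and sends the vectors fixed by the
restricted diagonal action of `Γ'` (`b ⊗ x ↦ φ(τ) b ⊗ rE(τ) x`) into `D_B(Ind rE) = (B ⊗ Ind rE)^Γ`:
for `g ∈ Γ` with `g tᵢ = t_{π i} φ(uᵢ)`, `g · (tᵢ ⊗ embᵢ) y = (t_{π i} ⊗ emb_{π i}) (uᵢ · y)`.  This is
the covariant form of `Hom_{Γ_K}(V, B) ≅ Hom_{Γ_L}(W, B|_{Γ_L})` (Patrikis 2019, proof of Lemma 7.2.1).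
[cite: Patrikis2019, Lemma 7.2.1 (proof)] [cite: SerreLinearRepresentations1977, §3.3 Thm. 12 (proof)] -/
theorem exists_frobeniusReciprocity_map [IsTopologicalGroup Γ] {ι : Type} [Fintype ι] [DecidableEq ι]
    (φ : Γ' →* Γ) (hφ : IsOpenEmbedding φ) {t : ι → Γ}
    (ht : Function.Bijective fun i => (t i : Γ ⧸ φ.range)) {m : ℕ} (e : ι × Fin n ≃ Fin m)
    (rE : FramedRep Γ' A n)
    {T : Γ' → (𝔅.B ⊗[P] (Fin n → A) →ₗ[F] 𝔅.B ⊗[P] (Fin n → A))}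
    (hT : ∀ (τ : Γ') (b : 𝔅.B) (x : Fin n → A),
      T τ (b ⊗ₜ x) = (φ τ • b) ⊗ₜ (FramedRep.restrictScalars P rE τ x)) :
    ∃ Θ : 𝔅.B ⊗[P] (Fin n → A) →ₗ[F] 𝔅.B ⊗[P] (Fin m → A),
      Function.Injective Θ ∧
        ∀ y, (∀ τ, T τ y = y) →
          Θ y ∈ 𝔅.D (FramedRep.restrictScalars P (FramedRep.induce φ hφ t ht e rE)) := by
  classical
  -- the block embeddings `emb i : Aⁿ → A^m` and the block projection `proj i : A^m → Aⁿ`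
  obtain ⟨emb, hemb⟩ : ∃ emb : ι → ((Fin n → A) →ₗ[P] (Fin m → A)),
      ∀ i v c, emb i v c = if (e.symm c).1 = i then v (e.symm c).2 else 0 :=
    ⟨fun i =>
      { toFun := fun v c => if (e.symm c).1 = i then v (e.symm c).2 else 0
        map_add' := fun v w => funext fun c => by
          by_cases h : (e.symm c).1 = i <;> simp [h]
        map_smul' := fun a v => funext fun c => by
          by_cases h : (e.symm c).1 = i <;> simp [h] }, fun _ _ _ => rfl⟩
  obtain ⟨proj, hproj⟩ : ∃ proj : ι → ((Fin m → A) →ₗ[P] (Fin n → A)),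
      ∀ i v a, proj i v a = v (e (i, a)) :=
    ⟨fun i =>
      { toFun := fun v a => v (e (i, a))
        map_add' := fun _ _ => rfl
        map_smul' := fun _ _ => rfl }, fun _ _ _ => rfl⟩
  have hpe : ∀ i i' (v : Fin n → A), proj i (emb i' v) = if i' = i then v else 0 := by
    intro i i' v
    funext a
    rw [hproj, hemb, Equiv.symm_apply_apply]
    by_cases h : i' = i
    · subst h; simp
    · rw [if_neg (Ne.symm h), if_neg h, Pi.zero_apply]
  -- the map `Θ = ∑ᵢ tᵢ ⊗ embᵢ`
  let Θ : 𝔅.B ⊗[P] (Fin n → A) →ₗ[F] 𝔅.B ⊗[P] (Fin m → A) :=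
    ∑ i, AlgebraTensorModule.map (DistribMulAction.toModuleEnd F 𝔅.B (t i)) (emb i)
  have hΘ : ∀ y, Θ y = ∑ i, AlgebraTensorModule.map (DistribMulAction.toModuleEnd F 𝔅.B (t i)) (emb i) y :=
    fun y => LinearMap.sum_apply _ _ _
  -- a nonempty index set: the trivial coset
  obtain ⟨i₀, -⟩ := ht.2 ((1 : Γ) : Γ ⧸ φ.range)
  refine ⟨Θ, ?_, ?_⟩
  · -- injectivity: `(1 ⊗ proj i₀) ∘ Θ = t i₀ ⊗ 1`, and `t i₀ ⊗ 1` is invertible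
    have hL : ∀ y, AlgebraTensorModule.map (LinearMap.id : 𝔅.B →ₗ[F] 𝔅.B) (proj i₀) (Θ y) =
        AlgebraTensorModule.map (DistribMulAction.toModuleEnd F 𝔅.B (t i₀)) LinearMap.id y := by
      intro y
      rw [hΘ, map_sum]
      induction y using TensorProduct.induction_on with
      | zero => simp only [map_zero, Finset.sum_const_zero]
      | tmul b v =>
        simp only [AlgebraTensorModule.map_tmul, LinearMap.id_apply, hpe]
        rw [Finset.sum_eq_single i₀]
        · rw [if_pos rfl]
        · intro i _ hi
          rw [if_neg hi, tmul_zero]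
        · intro h; exact absurd (Finset.mem_univ i₀) h
      | add y z hy hz => simp only [map_add, Finset.sum_add_distrib, hy, hz]
    have hinv : ∀ y, AlgebraTensorModule.map (DistribMulAction.toModuleEnd F 𝔅.B (t i₀)⁻¹) LinearMap.id
        (AlgebraTensorModule.map (DistribMulAction.toModuleEnd F 𝔅.B (t i₀))
          (LinearMap.id : (Fin n → A) →ₗ[P] (Fin n → A)) y) = y := by
      intro y
      rw [← LinearMap.comp_apply, ← AlgebraTensorModule.map_comp, ← Module.End.mul_eq_comp,
        ← map_mul, inv_mul_cancel, map_one, Module.End.one_eq_id, LinearMap.id_comp,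
        AlgebraTensorModule.map_id, LinearMap.id_apply]
    intro y z hyz
    have h := congrArg (fun w => AlgebraTensorModule.map (DistribMulAction.toModuleEnd F 𝔅.B (t i₀)⁻¹)
      (LinearMap.id : (Fin n → A) →ₗ[P] (Fin n → A))
        (AlgebraTensorModule.map (LinearMap.id : 𝔅.B →ₗ[F] 𝔅.B) (proj i₀) w)) hyz
    simp only [hL, hinv] at h
    exact h
  · -- `Θ` maps the `Γ'`-fixed vectors into the `Γ`-invariants of `B ⊗ Ind(rE)`
    intro y hy
    rw [mem_D_iff]
    intro g
    obtain ⟨π, u, hπ⟩ := exists_perm_mul_transversal_eq φ ht g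
    rw [hΘ, map_sum]
    -- `g · (tᵢ ⊗ embᵢ) y = (t_{π i} ⊗ emb_{π i}) (T_{uᵢ} y) = (t_{π i} ⊗ emb_{π i}) y`
    have hterm : ∀ i, 𝔅.tensorRep (FramedRep.restrictScalars P (FramedRep.induce φ hφ t ht e rE)) g
        (AlgebraTensorModule.map (DistribMulAction.toModuleEnd F 𝔅.B (t i)) (emb i) y) =
          AlgebraTensorModule.map (DistribMulAction.toModuleEnd F 𝔅.B (t (π i))) (emb (π i)) y := by
      intro i
      have hTu' : ∀ y', AlgebraTensorModule.map (DistribMulAction.toModuleEnd F 𝔅.B (φ (u i)))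
          ((FramedRep.restrictScalars P rE (u i) : (Fin n → A) →ₗ[P] (Fin n → A))) y' = T (u i) y' := by
        intro y'
        induction y' using TensorProduct.induction_on with
        | zero => rw [map_zero, map_zero]
        | tmul b v => rw [AlgebraTensorModule.map_tmul, hT]; rfl
        | add y' z' hy' hz' => rw [map_add, map_add, hy', hz']
      have hTu : AlgebraTensorModule.map (DistribMulAction.toModuleEnd F 𝔅.B (φ (u i)))
          ((FramedRep.restrictScalars P rE (u i) : (Fin n → A) →ₗ[P] (Fin n → A))) y = y := by
        rw [hTu', hy]
      change AlgebraTensorModule.map (DistribMulAction.toModuleEnd F 𝔅.B g)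
          ((FramedRep.restrictScalars P (FramedRep.induce φ hφ t ht e rE) g :
            (Fin m → A) →ₗ[P] (Fin m → A)))
          (AlgebraTensorModule.map (DistribMulAction.toModuleEnd F 𝔅.B (t i)) (emb i) y) = _
      rw [← LinearMap.comp_apply, ← AlgebraTensorModule.map_comp, ← Module.End.mul_eq_comp, ← map_mul,
        hπ i, restrictScalars_induce_comp_emb φ hφ ht e rE hemb (hπ i), map_mul,
        Module.End.mul_eq_comp, AlgebraTensorModule.map_comp, LinearMap.comp_apply, hTu]
    simp only [hterm]
    exact Equiv.sum_comp π (fun i => AlgebraTensorModule.map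
      (DistribMulAction.toModuleEnd F 𝔅.B (t i)) (emb i) y)


/-- **Induction preserves `B`-admissibility (abstract Shapiro lemma for period rings).**  Let
`φ : Γ' → Γ` be an open embedding of topological groups with finite transversal `t : ι → Γ` of
`Γ / φ(Γ')`, `𝔅 = (B, Γ, F)` and `𝔅' = (B', Γ', F')` period-ring data over `P`, `Φ : B ≃ B'` a
`P`-linear ring isomorphism with `Φ (φ(τ) b) = τ Φ(b)`, and `S ⊆ B` an `F`-subspace of dimension
`≥ |ι| = [Γ : φ(Γ')]` fixed pointwise by `φ(Γ')` (in the application: `B = B_dR(K)`, `B' = B_dR(L)`,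
`φ = res_{L/K}`, `S = L ⊆ K̄ ⊆ B_dR(K)`, `dim_K S = [L : K] = [Γ_K : Γ_L]`).  If the `P`-restriction of
a framed `rE : Γ' → GL_n(A)` (`A/P` finite) is `B'`-admissible, then the `P`-restriction of the induced
`Ind(rE) : Γ → GL_m(A)` (`FramedRep.induce`, matrix form) is `B`-admissible.  Proof (Patrikis 2019,
Lemma 7.2.1, "comparing dimensions" after Frobenius reciprocity): `B ⊗ Aⁿ` has `N = dim_P Aⁿ` vectors
`x_j`, `B`-free and fixed by `φ(Γ')` (`exists_linearIndependent_invariant_of_isAdmissible`); the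
`F`-linear map `(c_j) ↦ Θ (∑ c_j x_j)`, `S^N → D_B(Ind rE)` (`exists_frobeniusReciprocity_map`) is
injective, so `dim_F D_B(Ind rE) ≥ N · |ι| = dim_P A^m`, and Fontaine's inequality (`finrank_D_le_holds`)
is the reverse bound. [cite: Patrikis2019, Lemma 7.2.1] [cite: FontaineAsterisque223III, Exp. III Thm. 1.5.2] -/
theorem isAdmissible_restrictScalars_induce [IsTopologicalGroup Γ] [FiniteDimensional P A]
    {ι : Type} [Fintype ι] [DecidableEq ι]
    (φ : Γ' →* Γ) (hφ : IsOpenEmbedding φ) {t : ι → Γ}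
    (ht : Function.Bijective fun i => (t i : Γ ⧸ φ.range)) {m : ℕ} (e : ι × Fin n ≃ Fin m)
    (Φ : 𝔅.B ≃+* 𝔅'.B) (hΦP : ∀ c : P, Φ (algebraMap P 𝔅.B c) = algebraMap P 𝔅'.B c)
    (hΦ : ∀ (τ : Γ') (b : 𝔅.B), Φ (φ τ • b) = τ • Φ b)
    (S : Submodule F 𝔅.B) (hS : ∀ (τ : Γ'), ∀ s ∈ S, φ τ • s = s)
    (hSrank : Fintype.card ι ≤ Module.finrank F S)
    (rE : FramedRep Γ' A n) (hadm : 𝔅'.IsAdmissible (FramedRep.restrictScalars P rE)) :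
    𝔅.IsAdmissible (FramedRep.restrictScalars P (FramedRep.induce φ hφ t ht e rE)) := by
  classical
  obtain ⟨T, hT⟩ := 𝔅.exists_restrictedTensorAction φ rE
  obtain ⟨x, hxli, hxT⟩ :=
    𝔅.exists_linearIndependent_invariant_of_isAdmissible 𝔅' φ rE Φ hΦP hΦ hT hadm
  obtain ⟨Θ, hΘinj, hΘD⟩ := 𝔅.exists_frobeniusReciprocity_map φ hφ ht e rE hT
  -- `Λ : S^N → B ⊗ Aⁿ`, `(c_j) ↦ ∑ c_j • x_j`: injective, with `φ(Γ')`-fixed values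
  let Λ : (Fin (Module.finrank P (Fin n → A)) → S) →ₗ[F] 𝔅.B ⊗[P] (Fin n → A) :=
    { toFun := fun c => ∑ j, ((c j : S) : 𝔅.B) • x j
      map_add' := fun c c' => by
        rw [← Finset.sum_add_distrib]
        exact Finset.sum_congr rfl fun j _ => by
          rw [Pi.add_apply, Submodule.coe_add, add_smul]
      map_smul' := fun a c => by
        rw [RingHom.id_apply, Finset.smul_sum]
        exact Finset.sum_congr rfl fun j _ => by
          rw [Pi.smul_apply, Submodule.coe_smul, smul_assoc] }
  have hΛ : ∀ c : Fin (Module.finrank P (Fin n → A)) → S, Λ c = ∑ j, ((c j : S) : 𝔅.B) • x j := fun c => rfl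
  have hΛinj : Function.Injective Λ := by
    rw [← LinearMap.ker_eq_bot, LinearMap.ker_eq_bot']
    intro c hc
    rw [hΛ] at hc
    have h := linearIndependent_iff'.1 hxli Finset.univ (fun j => ((c j : S) : 𝔅.B)) hc
    funext j
    exact Subtype.ext (h j (Finset.mem_univ j))
  have hΛT : ∀ (c : Fin (Module.finrank P (Fin n → A)) → S) (τ : Γ'), T τ (Λ c) = Λ c := fun c τ => by
    rw [hΛ, map_sum]
    exact Finset.sum_congr rfl fun j _ => by
      rw [𝔅.restrictedTensorAction_smul φ rE hT, hS τ _ (c j).2, hxT]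
  -- the injective `F`-linear map `S^N → D_B(Ind rE)`
  let Ψ : (Fin (Module.finrank P (Fin n → A)) → S) →ₗ[F] 𝔅.D (FramedRep.restrictScalars P (FramedRep.induce φ hφ t ht e rE)) :=
    LinearMap.codRestrict _ (Θ ∘ₗ Λ) fun c => hΘD _ (hΛT c)
  have hΨinj : Function.Injective Ψ := by
    intro c c' h
    have h' : Θ (Λ c) = Θ (Λ c') := congrArg Subtype.val h
    exact hΛinj (hΘinj h')
  -- dimension count
  haveI := 𝔅.finite_D (FramedRep.restrictScalars P (FramedRep.induce φ hφ t ht e rE))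
  obtain ⟨i₀, -⟩ := ht.2 ((1 : Γ) : Γ ⧸ φ.range)
  have hcard : 0 < Fintype.card ι := Fintype.card_pos_iff.2 ⟨i₀⟩
  haveI : Module.Finite F S := Module.finite_of_finrank_pos (hcard.trans_le hSrank)
  have h1 : Module.finrank F (Fin (Module.finrank P (Fin n → A)) → S) ≤
      Module.finrank F (𝔅.D (FramedRep.restrictScalars P (FramedRep.induce φ hφ t ht e rE))) :=
    LinearMap.finrank_le_finrank_of_injective hΨinj
  have h2 : Module.finrank F (Fin (Module.finrank P (Fin n → A)) → S) =
      Module.finrank P (Fin n → A) * Module.finrank F S := by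
    rw [Module.finrank_pi_fintype, Finset.sum_const, Finset.card_univ, Fintype.card_fin, smul_eq_mul]
  have hm : Fintype.card ι * n = m := by
    have h := Fintype.card_congr e
    rwa [Fintype.card_prod, Fintype.card_fin, Fintype.card_fin] at h
  have h3 : Module.finrank P (Fin m → A) = Fintype.card ι * Module.finrank P (Fin n → A) := by
    rw [Module.finrank_pi_fintype, Module.finrank_pi_fintype, Finset.sum_const, Finset.sum_const,
      Finset.card_univ, Finset.card_univ, Fintype.card_fin, Fintype.card_fin, smul_eq_mul, smul_eq_mul,
      ← hm, mul_assoc]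
  refine le_antisymm (𝔅.finrank_D_le_holds _) ?_
  rw [h3]
  calc Fintype.card ι * Module.finrank P (Fin n → A)
        ≤ Module.finrank F S * Module.finrank P (Fin n → A) := Nat.mul_le_mul_right _ hSrank
    _ = Module.finrank F (Fin (Module.finrank P (Fin n → A)) → S) := by rw [h2, mul_comm]
    _ ≤ _ := h1


omit [IsTopologicalRing A] in
/-- **The rows of `Ind(rE)(g) · v`**: block `i` of `Ind(rE)(g) v` is `∑ⱼ ρ̇(tᵢ⁻¹ g tⱼ) vⱼ`. [folklore] -/
theorem induce_mulVec_apply [IsTopologicalGroup Γ] {ι : Type} [Fintype ι] [DecidableEq ι]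
    (φ : Γ' →* Γ) (hφ : IsOpenEmbedding φ) {t : ι → Γ}
    (ht : Function.Bijective fun i => (t i : Γ ⧸ φ.range)) {m : ℕ} (e : ι × Fin n ≃ Fin m)
    (W : FramedRep Γ' A n) (g : Γ) (v : Fin m → A) (i : ι) (a : Fin n) :
    (((FramedRep.induce φ hφ t ht e W g : GL (Fin m) A) : Matrix (Fin m) (Fin m) A) *ᵥ v) (e (i, a)) =
      ∑ j, (dotExtend φ W.toMatrixHom ((t i)⁻¹ * g * t j) *ᵥ fun b => v (e (j, b))) a := by
  rw [Matrix.mulVec, dotProduct, ← e.sum_comp, Fintype.sum_prod_type]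
  refine Finset.sum_congr rfl fun j _ => ?_
  simp only [FramedRep.induce_apply_coe_apply, Equiv.symm_apply_apply, Matrix.mulVec, dotProduct]

/-- **A representation is a quotient of the induction of its restriction**: for `rE : Γ → GL_n(A)`
and an open embedding `φ : Γ' → Γ` of finite index, `(vᵢ)ᵢ ↦ ∑ᵢ rE(tᵢ) vᵢ` is a `Γ`-equivariant
surjection `Ind(rE ∘ φ) → rE` (the counit of Frobenius reciprocity), so if the `P`-restriction of
`Ind(rE ∘ φ)` is `B`-admissible then so is that of `rE` (quotients of admissible representations are
admissible, Fontaine Exp. III Prop. 1.5.2, `isAdmissible_of_shortExact`).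
[cite: FontaineAsterisque223III, Prop. 1.5.2] [cite: SerreLinearRepresentations1977, §3.3 Thm. 12 (proof)] -/
theorem isAdmissible_restrictScalars_of_induce_comp [IsTopologicalGroup Γ] [FiniteDimensional P A]
    {ι : Type} [Fintype ι] [DecidableEq ι]
    (φ : Γ' →ₜ* Γ) (hφ : IsOpenEmbedding φ) {t : ι → Γ}
    (ht : Function.Bijective fun i => (t i : Γ ⧸ φ.toMonoidHom.range)) {m : ℕ} (e : ι × Fin n ≃ Fin m)
    (rE : FramedRep Γ A n)
    (h : 𝔅.IsAdmissible (FramedRep.restrictScalars P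
      (FramedRep.induce φ.toMonoidHom hφ t ht e (rE.comp φ)))) :
    𝔅.IsAdmissible (FramedRep.restrictScalars P rE) := by
  classical
  set I := FramedRep.induce φ.toMonoidHom hφ t ht e (rE.comp φ) with hI
  -- the counit `g (vᵢ)ᵢ = ∑ᵢ rE(tᵢ) vᵢ`
  obtain ⟨gq, hgq⟩ : ∃ gq : (Fin m → A) →ₗ[P] (Fin n → A),
      ∀ v, gq v = ∑ i, ((rE (t i) : GL (Fin n) A) : Matrix (Fin n) (Fin n) A) *ᵥ fun b => v (e (i, b)) :=
    ⟨{ toFun := fun v => ∑ i, ((rE (t i) : GL (Fin n) A) : Matrix (Fin n) (Fin n) A) *ᵥ fun b => v (e (i, b))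
       map_add' := fun v w => by
         rw [← Finset.sum_add_distrib]
         exact Finset.sum_congr rfl fun i _ => by rw [← Matrix.mulVec_add]; rfl
       map_smul' := fun c v => by
         rw [RingHom.id_apply, Finset.smul_sum]
         exact Finset.sum_congr rfl fun i _ => by
           rw [← algebraMap_smul A c, ← Matrix.mulVec_smul, algebraMap_smul]; rfl },
      fun _ => rfl⟩
  -- the blocks of `Ind(rE ∘ φ)` on `φ(Γ')`: `ρ̇(φ u) = rE(φ u)`
  have hdot : ∀ u : Γ', dotExtend φ.toMonoidHom (FramedRep.toMatrixHom (rE.comp φ)) (φ.toMonoidHom u) =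
      ((rE (φ u) : GL (Fin n) A) : Matrix (Fin n) (Fin n) A) := fun u =>
    dotExtend_apply_map hφ.injective _ u
  -- equivariance of the counit
  have hgeq : ∀ (σ : Γ) (v : Fin m → A), gq (FramedRep.restrictScalars P I σ v) =
      FramedRep.restrictScalars P rE σ (gq v) := by
    intro σ v
    obtain ⟨π, u, hπ⟩ := exists_perm_mul_transversal_eq φ.toMonoidHom ht σ
    rw [FramedRep.restrictScalars_apply_apply, FramedRep.restrictScalars_apply_apply, hgq, hgq,
      Matrix.mulVec_sum]
    -- block `i` of `I σ v` is `rE(φ u_{π⁻¹ i}) v_{π⁻¹ i}`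
    have hblock : ∀ i, (fun b => (((I σ : GL (Fin m) A) : Matrix (Fin m) (Fin m) A) *ᵥ v) (e (i, b))) =
        ((rE (φ (u (π.symm i))) : GL (Fin n) A) : Matrix (Fin n) (Fin n) A) *ᵥ fun b => v (e (π.symm i, b)) := by
      intro i
      funext a
      rw [hI, induce_mulVec_apply, Finset.sum_eq_single (π.symm i)]
      · have h1 : (t i)⁻¹ * σ * t (π.symm i) = φ.toMonoidHom (u (π.symm i)) := by
          rw [mul_assoc, hπ, Equiv.apply_symm_apply, inv_mul_cancel_left]
        rw [h1, hdot]
      · intro j _ hj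
        have h2 : (t i)⁻¹ * σ * t j = (t i)⁻¹ * (t (π j) * φ.toMonoidHom (u j)) := by rw [mul_assoc, hπ]
        have hnot : (t i)⁻¹ * (t (π j) * φ.toMonoidHom (u j)) ∉ φ.toMonoidHom.range := fun hmem =>
          hj (by rw [eq_of_inv_mul_mul_map_mem φ.toMonoidHom ht.1 hmem, Equiv.symm_apply_apply])
        rw [h2, dotExtend_of_not_mem _ _ hnot, Matrix.zero_mulVec, Pi.zero_apply]
      · intro hh; exact absurd (Finset.mem_univ _) hh
    simp only [hblock, Matrix.mulVec_mulVec, ← Units.val_mul, ← map_mul]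
    rw [← π.sum_comp]
    simp only [Equiv.symm_apply_apply]
    refine Finset.sum_congr rfl fun j _ => ?_
    rw [hπ j]
    rfl
  -- surjectivity of the counit
  obtain ⟨i₀, -⟩ := ht.2 ((1 : Γ) : Γ ⧸ φ.toMonoidHom.range)
  have hsurj : Function.Surjective gq := by
    intro w
    refine ⟨fun c => if (e.symm c).1 = i₀ then
      ((((rE (t i₀))⁻¹ : GL (Fin n) A) : Matrix (Fin n) (Fin n) A) *ᵥ w) (e.symm c).2 else 0, ?_⟩
    rw [hgq, Finset.sum_eq_single i₀]
    · simp only [Equiv.symm_apply_apply, if_true]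
      rw [Matrix.mulVec_mulVec, ← Units.val_mul, mul_inv_cancel, Units.val_one, Matrix.one_mulVec]
    · intro i _ hi
      simp only [Equiv.symm_apply_apply, if_neg hi]
      exact Matrix.mulVec_zero _
    · intro hh; exact absurd (Finset.mem_univ _) hh
  -- the kernel as a subrepresentation, and the short exact sequence
  obtain ⟨ρ₁, hρ₁⟩ := ContinuousRep.exists_subrep (FramedRep.restrictScalars P I) (LinearMap.ker gq)
    (fun σ x hx => by
      rw [LinearMap.mem_ker] at hx ⊢
      rw [hgeq, hx, map_zero])
  exact (𝔅.isAdmissible_of_shortExact ρ₁ (FramedRep.restrictScalars P I) (FramedRep.restrictScalars P rE)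
    (LinearMap.ker gq).subtype gq (fun σ x => (hρ₁ σ x).symm ▸ rfl) hgeq
    Subtype.val_injective hsurj (LinearMap.exact_subtype_ker_map gq) h).2

end Shapiro

end PeriodRingData

end Literature.NumberTheory.GaloisRepresentations

/-! ### The local induction theorem for Fontaine's `B_dR` and THE pinned data -/

namespace Literature.NumberTheory.PAdicHodge

open Field ValuativeRel WittVector
open Literature.NumberTheory.GaloisRepresentations
open Literature.NumberTheory.GaloisRepresentations.IsNonarchimedeanLocalField

section Local

variable {K L : Type} [Field K] [ValuativeRel K] [TopologicalSpace K] [IsNonarchimedeanLocalField K]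
  [CharZero K] [Field L] [ValuativeRel L] [TopologicalSpace L] [IsNonarchimedeanLocalField L]
  [CharZero L] [Algebra K L] {ℓ : ℕ} [Fact ℓ.Prime]

/-- **A continuous embedding of `ℓ`-adic local fields is finite**: both fields are finite over their
canonical copies of `ℚ_ℓ` (`PadicBase`), and `ℚ_ℓ → K → L` is a scalar tower because the continuous
embedding `ℚ_ℓ → L` is unique (`LocalField.eq_padicRingHom_of_continuous`); cf. the tree's
`algebra_isAlgebraic_of_continuous_algebraMap`. [cite: NeukirchANT1999, Ch. II (5.2)] -/
theorem finiteDimensional_of_continuous_algebraMap (hcont : Continuous (algebraMap K L))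
    (hK : valuation K (ℓ : K) < 1) (hL : valuation L (ℓ : L) < 1) : FiniteDimensional K L := by
  have huniq : (algebraMap K L).comp (LocalField.padicRingHom K ℓ hK) =
      LocalField.padicRingHom L ℓ hL :=
    LocalField.eq_padicRingHom_of_continuous L ℓ hL _
      (hcont.comp (LocalField.continuous_padicRingHom K ℓ hK))
  letI : Algebra (PadicBase L ℓ hL) K :=
    ((LocalField.padicRingHom K ℓ hK).comp (PadicBase.toPadic hL).toRingHom).toAlgebra
  haveI : IsScalarTower (PadicBase L ℓ hL) K L :=
    IsScalarTower.of_algebraMap_eq fun x => by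
      show PadicBase.emb hL x =
        algebraMap K L (LocalField.padicRingHom K ℓ hK (PadicBase.toPadic hL x))
      rw [PadicBase.emb_apply, ← huniq]
      rfl
  exact Module.Finite.of_restrictScalars_finite (PadicBase L ℓ hL) K L

-- Mathlib's own global value of `maxSynthPendingDepth` (nested instance problems on `𝔅.B ⊗[P] M`).
set_option maxSynthPendingDepth 3 in
/-- **Induction preserves `B_dR`-admissibility** (Patrikis 2019, Lemma 7.2.1, for the canonical
structures `LocalField.padicAlgebra`, `bdRPeriodRingData`; the pinning equations are hypotheses, as in
the tree's `isAdmissible_bdR_restrictField`, so that the statement applies verbatim to the `ε`-pinned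
datum `fontainePst`).  For a continuous embedding `K → L` of `ℓ`-adic local fields, a transversal `t` of
`Γ_K / res(Γ_L)` and a framed `rE : Γ_L → GL_n(E')` over a finite `E'/ℚ_ℓ` whose `ℚ_ℓ`-restriction is
`B_dR(L)`-admissible, the `ℚ_ℓ`-restriction of `Ind(rE) : Γ_K → GL_m(E')` is `B_dR(K)`-admissible:
the abstract Shapiro lemma `PeriodRingData.isAdmissible_restrictScalars_induce` with
`Φ : B_dR(K) ≃ B_dR(L)` (`exists_fracBdR_ringEquiv` ∘ `exists_integerC_ringEquiv`) and
`S = L ⊆ K̄ ⊆ B_dR(K)` (`algClosureToBdR ∘ absEmbedding`, of dimension `[L : K] = [Γ_K : res Γ_L]`,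
fixed by `res(Γ_L)`). [cite: Patrikis2019, Lemma 7.2.1] [cite: BrinonConrad2009, Prop. 6.3.8] -/
theorem isAdmissible_bdR_induce (hcont : Continuous (algebraMap K L))
    (hK : valuation K (ℓ : K) < 1) (hL : valuation L (ℓ : L) < 1)
    [Fact (¬ IsUnit ((ℓ : ℕ) : integerC K))]
    [IsAdicComplete (Ideal.span {((ℓ : ℕ) : integerC K)}) (integerC K)]
    [Fact (¬ IsUnit ((ℓ : ℕ) : integerC L))]
    [IsAdicComplete (Ideal.span {((ℓ : ℕ) : integerC L)}) (integerC L)]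
    (algK : Algebra ℚ_[ℓ] K) (𝔅K : PeriodRingData.{0, 0, 0, 0} (absoluteGaloisGroup K) ℚ_[ℓ] K)
    (halgK : algK = LocalField.padicAlgebra K ℓ hK)
    (h𝔅K : 𝔅K = bdRPeriodRingData (F := K) (p := ℓ) hK)
    (algL : Algebra ℚ_[ℓ] L) (𝔅L : PeriodRingData.{0, 0, 0, 0} (absoluteGaloisGroup L) ℚ_[ℓ] L)
    (halgL : algL = LocalField.padicAlgebra L ℓ hL)
    (h𝔅L : 𝔅L = bdRPeriodRingData (F := L) (p := ℓ) hL)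
    [FiniteDimensional K L] {ι : Type} [Fintype ι] [DecidableEq ι]
    {t : ι → absoluteGaloisGroup K}
    (ht : Function.Bijective fun i =>
      (t i : absoluteGaloisGroup K ⧸ (absGaloisRestrict K L).toMonoidHom.range))
    {n m : ℕ} (e : ι × Fin n ≃ Fin m)
    {E' : IntermediateField ℚ_[ℓ] (PadicAlgCl ℓ)} [FiniteDimensional ℚ_[ℓ] E']
    (rE : FramedRep (absoluteGaloisGroup L) E' n)
    (hadm : 𝔅L.IsAdmissible (FramedRep.restrictScalars ℚ_[ℓ] rE)) :
    𝔅K.IsAdmissible (FramedRep.restrictScalars ℚ_[ℓ]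
      (FramedRep.induce (absGaloisRestrict K L).toMonoidHom (isOpenEmbedding_absGaloisRestrict K L)
        t ht e rE)) := by
  subst halgK halgL
  subst h𝔅K h𝔅L
  letI : Algebra ℚ_[ℓ] K := LocalField.padicAlgebra K ℓ hK
  letI : Algebra ℚ_[ℓ] L := LocalField.padicAlgebra L ℓ hL
  haveI := algebra_isAlgebraic_of_continuous_algebraMap hcont hK hL
  -- `Φ : B_dR(K) ≃ B_dR(L)`, `ℚ_ℓ`-linear and equivariant through `res`
  obtain ⟨g, hg⟩ := exists_integerC_ringEquiv (absClosureEmbedding_bijective K L)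
    (exists_algNorm_absClosureEmbedding_eq_rpow hcont hK hL)
  obtain ⟨Φ, hΦ, hΦq⟩ := exists_fracBdR_ringEquiv (ℓ := ℓ) g hg
  have hFK : Function.Surjective (fontaineTheta (integerC K) ℓ) := surjective_fontaineTheta_integerC hK
  have hFL : Function.Surjective (fontaineTheta (integerC L) ℓ) := surjective_fontaineTheta_integerC hL
  have hΦP : ∀ q : ℚ_[ℓ], Φ (algebraMap ℚ_[ℓ] (bdRPeriodRingData (F := K) (p := ℓ) hK).B q) =
      algebraMap ℚ_[ℓ] (bdRPeriodRingData (F := L) (p := ℓ) hL).B q := by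
    intro q
    have h1 : algebraMap ℚ_[ℓ] (bdRPeriodRingData (F := K) (p := ℓ) hK).B q =
        algebraMap (BDeRhamPlus (integerC K) ℓ) (FracBdR K ℓ) (qpToBdR q) := by
      rw [PeriodRingData.algebraMap_eq]
      change algebraMap (BDeRhamPlus (integerC K) ℓ) (FracBdR K ℓ)
        (embBdRHom hK hFK (LocalField.padicRingHom K ℓ hK q)) = _
      rw [show LocalField.padicRingHom K ℓ hK q = algebraMap (PadicBase K ℓ hK) K ((PadicBase.toPadic hK).symm q)
        from rfl, embBdRHom_algebraMap]
      rfl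
    have h2 : algebraMap ℚ_[ℓ] (bdRPeriodRingData (F := L) (p := ℓ) hL).B q =
        algebraMap (BDeRhamPlus (integerC L) ℓ) (FracBdR L ℓ) (qpToBdR q) := by
      rw [PeriodRingData.algebraMap_eq]
      change algebraMap (BDeRhamPlus (integerC L) ℓ) (FracBdR L ℓ)
        (embBdRHom hL hFL (LocalField.padicRingHom L ℓ hL q)) = _
      rw [show LocalField.padicRingHom L ℓ hL q = algebraMap (PadicBase L ℓ hL) L ((PadicBase.toPadic hL).symm q)
        from rfl, embBdRHom_algebraMap]
      rfl
    rw [h1, h2]; exact hΦq q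
  -- `S = L ⊆ K̄ ⊆ B_dR(K)`
  let jK : AlgebraicClosure K →+* (bdRPeriodRingData (F := K) (p := ℓ) hK).B :=
    (algebraMap (BDeRhamPlus (integerC K) ℓ) (FracBdR K ℓ)).comp (algClosureToBdR hK hFK)
  have hjK : ∀ a : K, jK (algebraMap K (AlgebraicClosure K) a) =
      algebraMap K (bdRPeriodRingData (F := K) (p := ℓ) hK).B a := fun a =>
    algClosureToFracBdR_algebraMap hK a
  let jL : L →ₐ[K] (bdRPeriodRingData (F := K) (p := ℓ) hK).B :=
    { toRingHom := jK.comp (absEmbedding K L).toRingHom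
      commutes' := fun a => by
        change jK (absEmbedding K L (algebraMap K L a)) = _
        rw [AlgHom.commutes, hjK] }
  have hjL : ∀ y : L, jL y = jK (absEmbedding K L y) := fun _ => rfl
  let S : Submodule K (bdRPeriodRingData (F := K) (p := ℓ) hK).B := LinearMap.range jL.toLinearMap
  have hS : ∀ (τ : absoluteGaloisGroup L), ∀ s ∈ S, (absGaloisRestrict K L).toMonoidHom τ • s = s := by
    rintro τ _ ⟨y, rfl⟩
    have key := smul_algClosureToFracBdR hK (absGaloisRestrict K L τ) (absEmbedding K L y)
    rw [absGaloisRestrict_smul_absEmbedding] at key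
    exact key
  have hSrank : Fintype.card ι ≤ Module.finrank K S := by
    have hinj : Function.Injective jL.toLinearMap := jL.toRingHom.injective
    rw [LinearMap.finrank_range_of_inj hinj, ← nat_card_quotient_range_absGaloisRestrict K L,
      ← Nat.card_eq_of_bijective _ ht, Nat.card_eq_fintype_card]
  exact PeriodRingData.isAdmissible_restrictScalars_induce (bdRPeriodRingData (F := K) (p := ℓ) hK)
    (bdRPeriodRingData (F := L) (p := ℓ) hL) (absGaloisRestrict K L).toMonoidHom
    (isOpenEmbedding_absGaloisRestrict K L) ht e Φ hΦP hΦ S hS hSrank rE hadm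

/-- **THE LOCAL INDUCTION THEOREM FOR THE PINNED DATA (Patrikis 2019, Lemma 7.2.1).**  For a continuous
embedding `K → L` of characteristic-`0` non-archimedean local fields of residue characteristic `ℓ`, any
transversal `t` of `Γ_K / res(Γ_L)` (`res = absGaloisRestrict K L`, an open embedding of index `[L : K]`)
and relabelling `e`, and a framed `W : Γ_L →ₜ* GL_n(ℚ̄_ℓ)` de Rham for THE datum `fontainePst L ℓ hL`,
the induced representation `Ind_{Γ_L}^{Γ_K} W` (`FramedRep.induce res _ t _ e W`, matrix form) is de Rham
for `fontainePst K ℓ hK`.  "Let `L/K/ℚ_ℓ` be finite, and let `W` be a de Rham representation of `Γ_L`. Then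
`V = Ind_L^K W` is also de Rham" — proved, as printed, by Frobenius reciprocity and a dimension count
(`isAdmissible_bdR_induce`), on a finite `ℚ_ℓ`-model `rE` of `W` (`Ind W` has the model `Ind rE`:
`FramedRep.induce_conj`, `FramedRep.induce_baseChange`).
[cite: Patrikis2019, Lemma 7.2.1 (§7.2; arXiv:1207.6724 p. 38)] -/
theorem isDeRhamFramed_fontainePst_induce (hcont : Continuous (algebraMap K L))
    (hK : valuation K (ℓ : K) < 1) (hL : valuation L (ℓ : L) < 1) [FiniteDimensional K L]
    {ι : Type} [Fintype ι] [DecidableEq ι] {t : ι → absoluteGaloisGroup K}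
    (ht : Function.Bijective fun i =>
      (t i : absoluteGaloisGroup K ⧸ (absGaloisRestrict K L).toMonoidHom.range))
    {n m : ℕ} (e : ι × Fin n ≃ Fin m)
    (W : FramedRep (absoluteGaloisGroup L) (PadicAlgCl ℓ) n) (hW : (fontainePst L ℓ hL).IsDeRhamFramed W) :
    (fontainePst K ℓ hK).IsDeRhamFramed
      (FramedRep.induce (absGaloisRestrict K L).toMonoidHom (isOpenEmbedding_absGaloisRestrict K L)
        t ht e W) := by
  haveI : Fact (¬ IsUnit ((ℓ : ℕ) : integerC K)) := ⟨not_isUnit_natCast_integerC hK⟩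
  haveI : IsAdicComplete (Ideal.span {((ℓ : ℕ) : integerC K)}) (integerC K) :=
    isAdicComplete_integerC_natCast hK
  haveI : Fact (¬ IsUnit ((ℓ : ℕ) : integerC L)) := ⟨not_isUnit_natCast_integerC hL⟩
  haveI : IsAdicComplete (Ideal.span {((ℓ : ℕ) : integerC L)}) (integerC L) :=
    isAdicComplete_integerC_natCast hL
  obtain ⟨E', hfin, rE, ⟨P, hP⟩, hadm⟩ := hW
  haveI := hfin
  refine ⟨E', hfin, FramedRep.induce (absGaloisRestrict K L).toMonoidHom
    (isOpenEmbedding_absGaloisRestrict K L) t ht e rE, ⟨Units.map (FramedRep.blockScalar e).toMonoidHom P, ?_⟩, ?_⟩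
  · rw [← FramedRep.induce_baseChange, ← FramedRep.induce_conj, hP]
  · exact isAdmissible_bdR_induce (ℓ := ℓ) hcont hK hL (fontainePst K ℓ hK).algebra
      (fontainePst K ℓ hK).𝔅 (fontainePst_algebra_eq_padicAlgebra hK) (fontainePst_𝔅_eq_bdRPeriodRingData hK)
      (fontainePst L ℓ hL).algebra (fontainePst L ℓ hL).𝔅 (fontainePst_algebra_eq_padicAlgebra hL)
      (fontainePst_𝔅_eq_bdRPeriodRingData hL) ht e rE hadm

/-- **De Rham-ness descends along a finite extension of the base, for THE pinned data**
(Brinon–Conrad 2009, Prop. 6.3.8, "`V` is de Rham as a `G_K`-representation if and only if `V` is de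
Rham as a `G_{K'}`-representation", converse half; the body of the named fact
`Literature.NumberTheory.PAdicHodge.DeRhamDescent`): for a continuous embedding `K → L` of
characteristic-`0` `ℓ`-adic local fields and a framed `ρ : Γ_K →ₜ* GL_n(ℚ̄_ℓ)` whose restriction
`ρ ∘ res_{L/K}` is de Rham for `fontainePst L ℓ hL`, `ρ` is de Rham for `fontainePst K ℓ hK`.  Proof:
`Ind_{Γ_L}^{Γ_K}(ρ|_{Γ_L})` is de Rham by the local induction theorem
(`isDeRhamFramed_fontainePst_induce`); `ρ` is its quotient by the counit of Frobenius reciprocity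
(`PeriodRingData.isAdmissible_restrictScalars_of_induce_comp`, on a finite `ℚ_ℓ`-model of `ρ`,
`exists_hasQlModel_holds`, with model independence `isDeRhamFramed_iff_of_hasQlModel`).
[cite: BrinonConrad2009, Prop. 6.3.8] [cite: Patrikis2019, Lemma 7.2.1] -/
theorem isDeRhamFramed_of_isDeRhamFramed_comp_absGaloisRestrict (hcont : Continuous (algebraMap K L))
    (hK : valuation K (ℓ : K) < 1) (hL : valuation L (ℓ : L) < 1) {n : ℕ}
    (ρ : FramedRep (absoluteGaloisGroup K) (PadicAlgCl ℓ) n)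
    (h : (fontainePst L ℓ hL).IsDeRhamFramed (ρ.comp (absGaloisRestrict K L))) :
    (fontainePst K ℓ hK).IsDeRhamFramed ρ := by
  classical
  haveI : FiniteDimensional K L := finiteDimensional_of_continuous_algebraMap hcont hK hL
  -- a finite model of `ρ`, and the induced models
  obtain ⟨E, rE, hfin, P, hP⟩ := Literature.NumberTheory.Automorphic.exists_hasQlModel_holds ρ
  haveI := hfin
  set t := absGaloisCosetRep K L rfl with ht_def
  have ht : Function.Bijective fun i =>
      (t i : absoluteGaloisGroup K ⧸ (absGaloisRestrict K L).toMonoidHom.range) :=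
    absGaloisCosetRep_bijective K L rfl
  have hmodel' : Literature.NumberTheory.Automorphic.HasQlModel (ρ.comp (absGaloisRestrict K L)) E
      (rE.comp (absGaloisRestrict K L)) := ⟨P, by rw [← hP]; exact ContinuousMonoidHom.ext fun _ => rfl⟩
  -- `Ind (ρ|Γ_L)` is de Rham (local induction theorem) with model `Ind (rE|Γ_L)`
  have hInd := isDeRhamFramed_fontainePst_induce hcont hK hL ht
    (finProdFinEquiv : Fin (Module.finrank K L) × Fin n ≃ Fin (Module.finrank K L * n))
    (ρ.comp (absGaloisRestrict K L)) h
  have hmodelI : Literature.NumberTheory.Automorphic.HasQlModel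
      (FramedRep.induce (absGaloisRestrict K L).toMonoidHom (isOpenEmbedding_absGaloisRestrict K L) t ht
        finProdFinEquiv (ρ.comp (absGaloisRestrict K L))) E
      (FramedRep.induce (absGaloisRestrict K L).toMonoidHom (isOpenEmbedding_absGaloisRestrict K L) t ht
        finProdFinEquiv (rE.comp (absGaloisRestrict K L))) := by
    obtain ⟨P', hP'⟩ := hmodel'
    exact ⟨Units.map (FramedRep.blockScalar finProdFinEquiv).toMonoidHom P', by
      rw [← FramedRep.induce_baseChange, ← FramedRep.induce_conj, hP']⟩
  have hadmI := ((fontainePst K ℓ hK).isDeRhamFramed_iff_of_hasQlModel hmodelI).1 hInd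
  refine ⟨E, hfin, rE, ⟨P, hP⟩, ?_⟩
  letI := (fontainePst K ℓ hK).algebra
  exact (fontainePst K ℓ hK).𝔅.isAdmissible_restrictScalars_of_induce_comp (absGaloisRestrict K L)
    (isOpenEmbedding_absGaloisRestrict K L) ht finProdFinEquiv rE hadmI

end Local

end Literature.NumberTheory.PAdicHodge

end
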